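import Summits.BirchSwinnertonDyer.BirchSwinnertonDyer.Theorems.Rank2Observatory2DescKillSig12Defs
import Summits.BirchSwinnertonDyer.BirchSwinnertonDyer.Theorems.Rank2Observatory2DescKillSig3
import HarnessLib

/-!
# KERNEL-2DESC — TIER-2u signature kill `sig12uCheck`, part 2 of 3: soundness tools at the UNRAMIFIED quadratic place
# (rank-2 observatory, cert-1 gen 38; overview in `Rank2Observatory2DescKillSig12Defs`)

HONEST FRAMING: per-curve certified theorems and census instruments; no claim on BSD in rank ≥ 2.
PARTITION: none — rank ≥ 2 data (N3); no r ≤ 1 cell claimed.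

Anisotropy of the norm form `C² − δB²` for a non-residue unit `δ` (`nm_unit`), the PAIR core lemma `core2` (from
`q^N ∣ q^s·U·X² − q^j·W` with unit norms and `j < N`: `s + j` even and equal Euler bits of the norms — a unit of `ℤ_{q²}` is a
square iff its norm is a square mod `q`), `quadMis_sound`, the disc-walk soundness `walk2_sound` and the scaled kill
`kill_scaled` (walk at offset `K = 2τ`). Integers and `ZMod` only. [cite: Cassels1991LecturesEllipticCurves, §15]
-/

-- single-conjunct summit: `Summit.BirchSwinnertonDyer.BirchSwinnertonDyer.…` repeats the name by design
set_option linter.dupNamespace false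

namespace Summit.BirchSwinnertonDyer.BirchSwinnertonDyer.Rank2Observatory.TwoDescKill

/-! ### Soundness — tools at the quadratic place -/

/-- `eulerBit q 1 = true` for a prime `q`. [folklore] -/
theorem eulerBit_one {q : ℕ} (hq : q.Prime) : eulerBit q 1 = true := by
  have h1 : (1 : ℤ) % (q : ℤ) = 1 := Int.emod_eq_of_lt (by norm_num) (by exact_mod_cast hq.one_lt)
  simp [eulerBit, h1, Nat.one_mod_eq_one.mpr hq.one_lt.ne']

/-- The Euler bit of a unit square is `true`. [folklore] -/
theorem eulerBit_sq {q : ℕ} (hq : q.Prime) {C : ℤ} (hC : ¬ (q : ℤ) ∣ C) : eulerBit q (C * C) = true := by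
  rw [← eulerBit_mul_sq hq hC (u := 1) (w := C * C) ⟨0, by ring⟩]
  exact eulerBit_one hq

/-- A pair with unit norm is `q`-primitive. [folklore] -/
theorem prim_of_nm {q dl C B : ℤ} (h : ¬ q ∣ nm dl C B) : ¬ (q ∣ C ∧ q ∣ B) := by
  rintro ⟨⟨x, hx⟩, ⟨y, hy⟩⟩
  exact h ⟨q * x * x - dl * q * y * y, by rw [nm, hx, hy]; ring⟩

/-- **Anisotropy**: for a non-residue unit `δ` the norm `C² − δB²` of a `q`-primitive pair is a unit
(the residue field of the unramified place is the field `𝔽_{q²}`). [folklore] -/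
theorem nm_unit {q : ℕ} (hq : q.Prime) {dl : ℤ} (hdl : ¬ (q : ℤ) ∣ dl) (hnr : eulerBit q dl = false)
    {C B : ℤ} (hprim : ¬ ((q : ℤ) ∣ C ∧ (q : ℤ) ∣ B)) : ¬ (q : ℤ) ∣ nm dl C B := by
  intro h
  have hpZ : Prime (q : ℤ) := Nat.prime_iff_prime_int.mp hq
  by_cases hB : (q : ℤ) ∣ B
  · apply hprim
    refine ⟨?_, hB⟩
    have e : C * C = nm dl C B + dl * B * B := by simp only [nm]; ring
    have hCC : (q : ℤ) ∣ C * C := by rw [e]; exact dvd_add h (hB.mul_left _)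
    exact (hpZ.dvd_mul.mp hCC).elim id id
  · have h1 : eulerBit q dl = eulerBit q (C * C) := by
      refine eulerBit_mul_sq hq hB ?_
      have e : dl * B ^ 2 - C * C = -(nm dl C B) := by simp only [nm]; ring
      rw [e]; exact (dvd_neg).mpr h
    by_cases hC : (q : ℤ) ∣ C
    · have e : dl * B * B = C * C - nm dl C B := by simp only [nm]; ring
      have hd : (q : ℤ) ∣ dl * B * B := by rw [e]; exact dvd_sub (hC.mul_left _) h
      rcases hpZ.dvd_mul.mp hd with h' | h'
      · rcases hpZ.dvd_mul.mp h' with h'' | h''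
        · exact hdl h''
        · exact hB h''
      · exact hB h'
    · rw [eulerBit_sq hq hC] at h1
      rw [h1] at hnr
      cases hnr

/-- Congruent pairs have congruent norms. [folklore] -/
theorem nm_congr {q dl C B C' B' : ℤ} (hC : q ∣ C - C') (hB : q ∣ B - B') :
    q ∣ nm dl C B - nm dl C' B' := by
  have e : nm dl C B - nm dl C' B' = (C - C') * (C + C') - dl * ((B - B') * (B + B')) := by
    simp only [nm]; ring
  rw [e]
  exact dvd_sub (hC.mul_right _) ((hB.mul_right _).mul_left _)

/-- A nonzero pair is `q^t` times a `q`-primitive pair. [folklore] -/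
theorem exists_pow_prim {q : ℕ} (hq : q.Prime) {C B : ℤ} (h : ¬ (C = 0 ∧ B = 0)) :
    ∃ (t : ℕ) (C' B' : ℤ), C = (q : ℤ) ^ t * C' ∧ B = (q : ℤ) ^ t * B' ∧
      ¬ ((q : ℤ) ∣ C' ∧ (q : ℤ) ∣ B') := by
  by_cases hC : C = 0
  · have hB : B ≠ 0 := fun hB => h ⟨hC, hB⟩
    obtain ⟨t, B', hB', hnd⟩ : ∃ (k : ℕ) (x' : ℤ), B = (q : ℤ) ^ k * x' ∧ ¬ (q : ℤ) ∣ x' :=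
      ⟨_, (Int.finiteMultiplicity_iff.mpr ⟨by simpa using hq.one_lt.ne', hB⟩).exists_eq_pow_mul_and_not_dvd⟩
    exact ⟨t, 0, B', by rw [hC, mul_zero], hB', fun h => hnd h.2⟩
  by_cases hB : B = 0
  · obtain ⟨t, C', hC', hnd⟩ : ∃ (k : ℕ) (x' : ℤ), C = (q : ℤ) ^ k * x' ∧ ¬ (q : ℤ) ∣ x' :=
      ⟨_, (Int.finiteMultiplicity_iff.mpr ⟨by simpa using hq.one_lt.ne', hC⟩).exists_eq_pow_mul_and_not_dvd⟩
    exact ⟨t, C', 0, hC', by rw [hB, mul_zero], fun h => hnd h.1⟩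
  obtain ⟨t₁, C', hC', hC'nd⟩ : ∃ (k : ℕ) (x' : ℤ), C = (q : ℤ) ^ k * x' ∧ ¬ (q : ℤ) ∣ x' :=
    ⟨_, (Int.finiteMultiplicity_iff.mpr ⟨by simpa using hq.one_lt.ne', hC⟩).exists_eq_pow_mul_and_not_dvd⟩
  obtain ⟨t₂, B', hB', hB'nd⟩ : ∃ (k : ℕ) (x' : ℤ), B = (q : ℤ) ^ k * x' ∧ ¬ (q : ℤ) ∣ x' :=
    ⟨_, (Int.finiteMultiplicity_iff.mpr ⟨by simpa using hq.one_lt.ne', hB⟩).exists_eq_pow_mul_and_not_dvd⟩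
  rcases le_or_gt t₁ t₂ with hle | hlt
  · obtain ⟨i, rfl⟩ : ∃ i, t₂ = t₁ + i := ⟨t₂ - t₁, by omega⟩
    exact ⟨t₁, C', (q : ℤ) ^ i * B', hC', by rw [hB', pow_add, mul_assoc], fun h => hC'nd h.1⟩
  · obtain ⟨i, rfl⟩ : ∃ i, t₁ = t₂ + i := ⟨t₁ - t₂, by omega⟩
    exact ⟨t₂, (q : ℤ) ^ i * C', B', by rw [hC', pow_add, mul_assoc], hB', fun h => hB'nd h.2⟩

/-- `q^N ∣ q^e·x − q^j·y` with `e < j` and `e < N` gives `q ∣ x`. [folklore] -/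
theorem dvd_of_lt_exp {q : ℕ} (hq0 : (q : ℤ) ≠ 0) {N e j : ℕ} {x y : ℤ}
    (h : (q : ℤ) ^ N ∣ (q : ℤ) ^ e * x - (q : ℤ) ^ j * y) (hej : e < j) (heN : e < N) :
    (q : ℤ) ∣ x := by
  have h2 : (q : ℤ) ^ (e + 1) ∣ (q : ℤ) ^ j * y := dvd_mul_of_dvd_left (pow_dvd_pow _ hej) _
  have h3 : (q : ℤ) ^ (e + 1) ∣ (q : ℤ) ^ e * x - (q : ℤ) ^ j * y := dvd_trans (pow_dvd_pow _ heN) h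
  have h1 : (q : ℤ) ^ (e + 1) ∣ (q : ℤ) ^ e * x := by simpa using dvd_add h3 h2
  rw [pow_succ] at h1
  exact (mul_dvd_mul_iff_left (pow_ne_zero e hq0)).mp h1

/-- `U·X²` for a nonzero pair `X = q^t·X'` (`X'` primitive) is `q^{2t}·A` with `nm A = nm U·ν²`, `ν = nm X'`
a unit, so `A` is primitive when `nm U` is a unit. [folklore] -/
theorem usq_decomp {q : ℕ} (hq : q.Prime) {dl : ℤ} (hdl : ¬ (q : ℤ) ∣ dl) (hnr : eulerBit q dl = false)
    {U X : ℤ × ℤ} (hU : ¬ (q : ℤ) ∣ nm dl U.1 U.2) (hX : ¬ (X.1 = 0 ∧ X.2 = 0)) :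
    ∃ (t : ℕ) (A : ℤ × ℤ) (ν : ℤ), ¬ (q : ℤ) ∣ ν ∧
      (pmul dl U (pmul dl X X)).1 = (q : ℤ) ^ (2 * t) * A.1 ∧
      (pmul dl U (pmul dl X X)).2 = (q : ℤ) ^ (2 * t) * A.2 ∧
      nm dl A.1 A.2 = nm dl U.1 U.2 * ν ^ 2 ∧ ¬ ((q : ℤ) ∣ A.1 ∧ (q : ℤ) ∣ A.2) ∧
      ((q : ℤ) ^ t ∣ X.1 ∧ (q : ℤ) ^ t ∣ X.2) := by
  have hpZ : Prime (q : ℤ) := Nat.prime_iff_prime_int.mp hq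
  obtain ⟨t, C', B', hC', hB', hprim⟩ := exists_pow_prim hq hX
  have hν : ¬ (q : ℤ) ∣ nm dl C' B' := nm_unit hq hdl hnr hprim
  have h2t : (q : ℤ) ^ (2 * t) = (q : ℤ) ^ t * (q : ℤ) ^ t := by rw [two_mul, pow_add]
  refine ⟨t, pmul dl U (pmul dl (C', B') (C', B')), nm dl C' B', hν, ?_, ?_, ?_, ?_, ⟨C', hC'⟩, ⟨B', hB'⟩⟩
  · rw [h2t]; simp only [pmul, hC', hB']; ring
  · rw [h2t]; simp only [pmul, hC', hB']; ring
  · simp only [nm, pmul]; ring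
  · apply prim_of_nm
    intro h
    have e : nm dl (pmul dl U (pmul dl (C', B') (C', B'))).1 (pmul dl U (pmul dl (C', B') (C', B'))).2 =
        nm dl U.1 U.2 * (nm dl C' B' * nm dl C' B') := by simp only [nm, pmul]; ring
    rw [e] at h
    rcases hpZ.dvd_mul.mp h with h | h
    · exact hU h
    · rcases hpZ.dvd_mul.mp h with h | h <;> exact hν h

/-- **Core lemma at the quadratic place.** `q^N ∣ q^s·U·X² − q^j·W` componentwise (pairs `C + Bη'`,
`η'² = δ`), with `nm U`, `nm W` units and `j < N`, forces `s + j` even and equal Euler bits of the norms: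
writing `X = q^t X'`, both `U·X'²` and `W` are primitive, so the exponents `s + 2t` and `j` agree and
`U·X'² ≡ W (mod q)`; a unit of `ℤ_{q²}` is a square iff its norm is a square mod `q`. No valuations. [folklore] -/
theorem core2 {q : ℕ} (hq : q.Prime) {dl : ℤ} (hdl : ¬ (q : ℤ) ∣ dl) (hnr : eulerBit q dl = false)
    {U W X : ℤ × ℤ} (hU : ¬ (q : ℤ) ∣ nm dl U.1 U.2) (hW : ¬ (q : ℤ) ∣ nm dl W.1 W.2) {s j N : ℕ}
    (hjN : j < N)
    (h1 : (q : ℤ) ^ N ∣ (q : ℤ) ^ s * (pmul dl U (pmul dl X X)).1 - (q : ℤ) ^ j * W.1)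
    (h2 : (q : ℤ) ^ N ∣ (q : ℤ) ^ s * (pmul dl U (pmul dl X X)).2 - (q : ℤ) ^ j * W.2) :
    (s + j) % 2 = 0 ∧ eulerBit q (nm dl U.1 U.2) = eulerBit q (nm dl W.1 W.2) := by
  have hq0 : (q : ℤ) ≠ 0 := by exact_mod_cast hq.ne_zero
  have hWp := prim_of_nm hW
  have hjd : ∀ {x : ℤ}, (q : ℤ) ^ N ∣ -((q : ℤ) ^ j * x) → (q : ℤ) ∣ x := by
    intro x hx
    have : (q : ℤ) ^ (j + 1) ∣ (q : ℤ) ^ j * x := dvd_neg.mp (dvd_trans (pow_dvd_pow _ hjN) hx)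
    rw [pow_succ] at this
    exact (mul_dvd_mul_iff_left (pow_ne_zero j hq0)).mp this
  by_cases hX : X.1 = 0 ∧ X.2 = 0
  · exfalso
    have e1 : (pmul dl U (pmul dl X X)).1 = 0 := by simp only [pmul, hX.1, hX.2]; ring
    have e2 : (pmul dl U (pmul dl X X)).2 = 0 := by simp only [pmul, hX.1, hX.2]; ring
    rw [e1, mul_zero, zero_sub] at h1
    rw [e2, mul_zero, zero_sub] at h2
    exact hWp ⟨hjd h1, hjd h2⟩
  obtain ⟨t, A, ν, hν, hA1, hA2, hnA, hAp, -⟩ := usq_decomp hq hdl hnr hU hX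
  rw [hA1, ← mul_assoc, ← pow_add] at h1
  rw [hA2, ← mul_assoc, ← pow_add] at h2
  have heq : s + 2 * t = j := by
    rcases Nat.lt_trichotomy (s + 2 * t) j with hlt | heq | hgt
    · exact absurd ⟨dvd_of_lt_exp hq0 h1 hlt (by omega), dvd_of_lt_exp hq0 h2 hlt (by omega)⟩ hAp
    · exact heq
    · refine absurd ⟨dvd_of_lt_exp hq0 (y := A.1) ?_ hgt hjN,
        dvd_of_lt_exp hq0 (y := A.2) ?_ hgt hjN⟩ hWp
      · rw [← neg_sub]; exact dvd_neg.mpr h1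
      · rw [← neg_sub]; exact dvd_neg.mpr h2
  refine ⟨by omega, ?_⟩
  rw [heq] at h1 h2
  have hc : ∀ {u w : ℤ}, (q : ℤ) ^ N ∣ (q : ℤ) ^ j * u - (q : ℤ) ^ j * w → (q : ℤ) ∣ u - w := by
    intro u w h
    have : (q : ℤ) ^ (j + 1) ∣ (q : ℤ) ^ j * (u - w) := by
      rw [mul_sub]; exact dvd_trans (pow_dvd_pow _ hjN) h
    rw [pow_succ] at this
    exact (mul_dvd_mul_iff_left (pow_ne_zero j hq0)).mp this
  rw [← eulerBit_congr (nm_congr (hc h1) (hc h2)), hnA]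
  exact eulerBit_mul_sq hq hν ⟨0, by ring⟩

/-- **Decided quadratic signature is sound**: for `y ≡ c (mod q^j)` on a disc where the quadratic centre is
decided, the pair relation `q^N ∣ q^{s₂}·U·X² − q^K·((y − E_C) − E_B η')` (`E_B = q^k B_u`, `K` even,
`K ≤ B`, `j + B < N`) forces the class signature `(s₂, ℓ₂)` to be `quadSigOf`. [cite: CremonaAlgorithms1997, §3.6] -/
theorem quadMis_sound {q : ℕ} (hq : q.Prime) {dl : ℤ} (hdl : ¬ (q : ℤ) ∣ dl) (hnr : eulerBit q dl = false)
    {U : ℤ × ℤ} (hU : ¬ (q : ℤ) ∣ nm dl U.1 U.2) {k : ℕ} {Bp Bu EC : ℤ} (hBu : ¬ (q : ℤ) ∣ Bu)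
    (hBp : (q : ℤ) ∣ Bu - Bp) {s₂ : ℕ} {c : ℤ} {j : ℕ}
    (h : quadMis q dl k Bp EC s₂ (eulerBit q (nm dl U.1 U.2)) c j = true)
    {B N K : ℕ} (hK : K ≤ B) (hK2 : K % 2 = 0) (hj : j + B < N) {y : ℤ} (hy : (q : ℤ) ^ j ∣ y - c)
    (hX : ∃ X : ℤ × ℤ,
      (q : ℤ) ^ N ∣ (q : ℤ) ^ s₂ * (pmul dl U (pmul dl X X)).1 - (q : ℤ) ^ K * (y - EC) ∧
      (q : ℤ) ^ N ∣ (q : ℤ) ^ s₂ * (pmul dl U (pmul dl X X)).2 - (q : ℤ) ^ K * (-((q : ℤ) ^ k * Bu))) :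
    False := by
  obtain ⟨X, hX1, hX2⟩ := hX
  have hpZ : Prime (q : ℤ) := Nat.prime_iff_prime_int.mp hq
  have hq0 : (q : ℤ) ≠ 0 := by exact_mod_cast hq.ne_zero
  have cast_qj : ((q ^ j : ℕ) : ℤ) = (q : ℤ) ^ j := Nat.cast_pow q j
  have cast_qk : ((q ^ k : ℕ) : ℤ) = (q : ℤ) ^ k := Nat.cast_pow q k
  simp only [quadMis, quadDecided, quadSigOf, Bool.and_eq_true, Bool.or_eq_true, Bool.not_eq_true',
    decide_eq_false_iff_not, decide_eq_true_eq, cast_qj, cast_qk] at h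
  obtain ⟨⟨hdec, hunit⟩, hmis⟩ := h
  have hsp := splitPow_spec q j (c - EC)
  set m₁ := (splitPow q j (c - EC)).1 with hm₁
  set w := (splitPow q j (c - EC)).2 with hw
  obtain ⟨t, ht⟩ := hy
  have hyE : y - EC = (q : ℤ) ^ j * t + (c - EC) := by linear_combination ht
  -- `v(c − E_C) < j` when `c − E_C ≢ 0 (mod q^j)`
  have hm₁j : ¬ (c - EC) % (q : ℤ) ^ j = 0 → m₁ < j := by
    intro hδ
    by_contra hle
    push Not at hle
    exact hδ (Int.emod_eq_zero_of_dvd (hsp ▸ dvd_mul_of_dvd_left (pow_dvd_pow _ hle) w))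
  by_cases hcase : ¬ (c - EC) % (q : ℤ) ^ j = 0 ∧ m₁ < k
  · -- (i) `v(y − E_C) = m₁ < k`: signature `(m₁, true)`
    rw [if_pos hcase] at hmis
    dsimp only at hmis
    obtain ⟨hδ, hm₁k⟩ := hcase
    have hw' : ¬ (q : ℤ) ∣ w := by
      intro hd
      rcases hunit with h0 | hu
      · exact hδ h0
      · exact hu (Int.emod_eq_zero_of_dvd hd)
    obtain ⟨i, hi⟩ : ∃ i, j = m₁ + (i + 1) := ⟨j - m₁ - 1, by have := hm₁j hδ; omega⟩
    obtain ⟨l, hl⟩ : ∃ l, k = m₁ + (l + 1) := ⟨k - m₁ - 1, by omega⟩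
    have hyE' : y - EC = (q : ℤ) ^ m₁ * (w + (q : ℤ) ^ (i + 1) * t) := by
      rw [hyE, hsp, hi, pow_add]; ring
    have hw'' : ¬ (q : ℤ) ∣ w + (q : ℤ) ^ (i + 1) * t := by
      intro h
      apply hw'
      have h2 : (q : ℤ) ∣ (q : ℤ) ^ (i + 1) * t := dvd_mul_of_dvd_left (dvd_pow_self _ (Nat.succ_ne_zero i)) t
      simpa using dvd_sub h h2
    -- `W' = (w', −q^{l+1} B_u)`, norm `≡ w'² (mod q)`
    have hWn : ¬ (q : ℤ) ∣ nm dl (w + (q : ℤ) ^ (i + 1) * t) (-((q : ℤ) ^ (l + 1) * Bu)) := by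
      intro h
      have hc : (q : ℤ) ∣ nm dl (w + (q : ℤ) ^ (i + 1) * t) (-((q : ℤ) ^ (l + 1) * Bu)) -
          nm dl (w + (q : ℤ) ^ (i + 1) * t) 0 :=
        nm_congr (by simp) ⟨-((q : ℤ) ^ l * Bu), by rw [pow_succ]; ring⟩
      have e : nm dl (w + (q : ℤ) ^ (i + 1) * t) 0 = (w + (q : ℤ) ^ (i + 1) * t) * (w + (q : ℤ) ^ (i + 1) * t) := by
        simp only [nm]; ring
      have : (q : ℤ) ∣ (w + (q : ℤ) ^ (i + 1) * t) * (w + (q : ℤ) ^ (i + 1) * t) := by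
        rw [← e]; simpa using dvd_sub h hc
      exact hw'' ((hpZ.dvd_mul.mp this).elim id id)
    have hr1 : (q : ℤ) ^ N ∣ (q : ℤ) ^ s₂ * (pmul dl U (pmul dl X X)).1 -
        (q : ℤ) ^ (K + m₁) * (w + (q : ℤ) ^ (i + 1) * t) := by
      have e : (q : ℤ) ^ K * (y - EC) = (q : ℤ) ^ (K + m₁) * (w + (q : ℤ) ^ (i + 1) * t) := by
        rw [hyE', pow_add]; ring
      rwa [e] at hX1
    have hr2 : (q : ℤ) ^ N ∣ (q : ℤ) ^ s₂ * (pmul dl U (pmul dl X X)).2 -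
        (q : ℤ) ^ (K + m₁) * (-((q : ℤ) ^ (l + 1) * Bu)) := by
      have e : (q : ℤ) ^ K * (-((q : ℤ) ^ k * Bu)) = (q : ℤ) ^ (K + m₁) * (-((q : ℤ) ^ (l + 1) * Bu)) := by
        rw [hl, pow_add, pow_add]; ring
      rwa [e] at hX2
    have hc := core2 hq hdl hnr hU (W := (w + (q : ℤ) ^ (i + 1) * t, -((q : ℤ) ^ (l + 1) * Bu))) hWn
      (by omega : K + m₁ < N) hr1 hr2
    have hbit : eulerBit q (nm dl (w + (q : ℤ) ^ (i + 1) * t) (-((q : ℤ) ^ (l + 1) * Bu))) = true := by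
      rw [eulerBit_congr (nm_congr (dl := dl) (C' := w + (q : ℤ) ^ (i + 1) * t) (B' := 0) (by simp)
        ⟨-((q : ℤ) ^ l * Bu), by rw [pow_succ]; ring⟩)]
      have e : nm dl (w + (q : ℤ) ^ (i + 1) * t) 0 = (w + (q : ℤ) ^ (i + 1) * t) * (w + (q : ℤ) ^ (i + 1) * t) := by
        simp only [nm]; ring
      rw [e]; exact eulerBit_sq hq hw''
    rcases hmis with hpar | hbit'
    · apply hpar
      have := hc.1
      omega
    · exact hbit' (hc.2.trans hbit).symm
  · -- (ii) signature `(k, bit)`: `y − E_C = q^k·D₁` with `D₁ ≡ (c − E_C)/q^k (mod q)`, and `k < j`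
    rw [if_neg hcase] at hmis
    dsimp only at hmis
    have main : k < j ∧ ∃ D₁ : ℤ, y - EC = (q : ℤ) ^ k * D₁ ∧ (q : ℤ) ∣ D₁ - (c - EC) / (q : ℤ) ^ k := by
      by_cases hδ : (c - EC) % (q : ℤ) ^ j = 0
      · have hkj : k + 1 ≤ j := hdec.resolve_left (fun h => h hδ)
        obtain ⟨d', hd'⟩ := Int.dvd_of_emod_eq_zero hδ
        obtain ⟨i, hi⟩ : ∃ i, j = k + (i + 1) := ⟨j - k - 1, by omega⟩
        refine ⟨by omega, (q : ℤ) ^ (i + 1) * (t + d'), ?_, ?_⟩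
        · rw [hyE, hd', hi, pow_add]; ring
        · have e : (c - EC) / (q : ℤ) ^ k = (q : ℤ) ^ (i + 1) * d' := by
            rw [hd', hi, pow_add, mul_assoc]
            exact Int.mul_ediv_cancel_left _ (pow_ne_zero _ hq0)
          rw [e, pow_succ]
          exact ⟨(q : ℤ) ^ i * t, by ring⟩
      · have hkm : k ≤ m₁ := by
          by_contra hlt
          push Not at hlt
          exact hcase ⟨hδ, hlt⟩
        have hm₁j' : m₁ < j := hm₁j hδ
        obtain ⟨i, hi⟩ : ∃ i, j = m₁ + (i + 1) := ⟨j - m₁ - 1, by omega⟩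
        obtain ⟨l, hl⟩ : ∃ l, m₁ = k + l := ⟨m₁ - k, by omega⟩
        refine ⟨by omega, (q : ℤ) ^ l * w + (q : ℤ) ^ (l + i + 1) * t, ?_, ?_⟩
        · have e : (c - EC) = (q : ℤ) ^ (k + l) * w := by rw [← hl]; exact hsp
          rw [hyE, e, hi, hl, pow_add, pow_add, pow_add, pow_add]; ring
        · have e : (c - EC) / (q : ℤ) ^ k = (q : ℤ) ^ l * w := by
            rw [hsp, hl, pow_add, mul_assoc]
            exact Int.mul_ediv_cancel_left _ (pow_ne_zero _ hq0)
          rw [e]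
          exact ⟨(q : ℤ) ^ (l + i) * t, by ring⟩
    obtain ⟨hkj, D₁, hD₁, hcong⟩ := main
    have hWn : ¬ (q : ℤ) ∣ nm dl D₁ (-Bu) :=
      nm_unit hq hdl hnr (fun h => hBu (dvd_neg.mp h.2))
    have hr1 : (q : ℤ) ^ N ∣ (q : ℤ) ^ s₂ * (pmul dl U (pmul dl X X)).1 - (q : ℤ) ^ (K + k) * D₁ := by
      have e : (q : ℤ) ^ K * (y - EC) = (q : ℤ) ^ (K + k) * D₁ := by rw [hD₁, pow_add]; ring
      rwa [e] at hX1
    have hr2 : (q : ℤ) ^ N ∣ (q : ℤ) ^ s₂ * (pmul dl U (pmul dl X X)).2 - (q : ℤ) ^ (K + k) * (-Bu) := by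
      have e : (q : ℤ) ^ K * (-((q : ℤ) ^ k * Bu)) = (q : ℤ) ^ (K + k) * (-Bu) := by rw [pow_add]; ring
      rwa [e] at hX2
    have hc := core2 hq hdl hnr hU (W := (D₁, -Bu)) hWn (by omega : K + k < N) hr1 hr2
    have hbit : eulerBit q (nm dl D₁ (-Bu)) =
        eulerBit q (nm dl (((c - EC) / (q : ℤ) ^ k) % (q : ℤ)) Bp) := by
      have e : nm dl D₁ (-Bu) = nm dl D₁ Bu := by simp only [nm]; ring
      rw [e]
      refine eulerBit_congr (nm_congr ?_ hBp)
      have h2 : (q : ℤ) ∣ (c - EC) / (q : ℤ) ^ k - ((c - EC) / (q : ℤ) ^ k) % (q : ℤ) :=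
        (Int.mod_modEq _ _).dvd
      simpa using dvd_add hcong h2
    rcases hmis with hpar | hbit'
    · apply hpar
      have := hc.1
      omega
    · exact hbit' (hc.2.trans hbit).symm

/-- The precision guard of a certified node. [folklore] -/
theorem walk2_guard {q : ℕ} {ρ : ℤ × ℕ × ℤ} {dl : ℤ} {k : ℕ} {Bp EC : ℤ} {s₂ : ℕ} {ℓ₂ : Bool} {B N : ℕ} :
    ∀ {f : ℕ} {c : ℤ} {j : ℕ}, walk2 q ρ dl k Bp EC s₂ ℓ₂ B N f c j = true → j + B < N
  | 0, c, j, h => by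
      simp only [walk2, Bool.and_eq_true, decide_eq_true_eq] at h; exact h.1
  | f + 1, c, j, h => by
      simp only [walk2, Bool.and_eq_true, decide_eq_true_eq] at h; exact h.1

/-- **Walk soundness** (TIER 2u): a certified node `(c, j)` admits no `y ≡ c (mod q^j)` for which both the
root relation `q^N ∣ q^{s₁}u₁X² − q^K(y − e₁)` and the pair relation
`q^N ∣ q^{s₂}·U·P² − q^K·((y − E_C) − E_B η')` are solvable (`K` even, `K ≤ B`).
[cite: CremonaAlgorithms1997, §3.6] -/
theorem walk2_sound {q : ℕ} (hq : q.Prime) {ρ : ℤ × ℕ × ℤ} (hρ : ¬ (q : ℤ) ∣ ρ.2.2) {dl : ℤ}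
    (hdl : ¬ (q : ℤ) ∣ dl) (hnr : eulerBit q dl = false) {U : ℤ × ℤ} (hU : ¬ (q : ℤ) ∣ nm dl U.1 U.2)
    {k : ℕ} {Bp Bu EC : ℤ} (hBu : ¬ (q : ℤ) ∣ Bu) (hBp : (q : ℤ) ∣ Bu - Bp) {s₂ B N K : ℕ}
    (hK : K ≤ B) (hK2 : K % 2 = 0) :
    ∀ (f : ℕ) (c : ℤ) (j : ℕ), walk2 q ρ dl k Bp EC s₂ (eulerBit q (nm dl U.1 U.2)) B N f c j = true →
      ∀ y : ℤ, (q : ℤ) ^ j ∣ y - c →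
      (∃ X : ℤ, (q : ℤ) ^ N ∣ (q : ℤ) ^ ρ.2.1 * ρ.2.2 * X ^ 2 - (q : ℤ) ^ K * (y - ρ.1)) →
      (∃ X : ℤ × ℤ,
        (q : ℤ) ^ N ∣ (q : ℤ) ^ s₂ * (pmul dl U (pmul dl X X)).1 - (q : ℤ) ^ K * (y - EC) ∧
        (q : ℤ) ^ N ∣ (q : ℤ) ^ s₂ * (pmul dl U (pmul dl X X)).2 - (q : ℤ) ^ K * (-((q : ℤ) ^ k * Bu))) →
      False
  | 0, c, j, h, y, hy, hX1, hX2 => by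
      simp only [walk2, Bool.and_eq_true, Bool.or_eq_true, decide_eq_true_eq] at h
      obtain ⟨hj, hm | hm⟩ := h
      · exact outMis_sound hq hρ hm hK hK2 hj hy hX1
      · exact quadMis_sound hq hdl hnr hU hBu hBp hm hK hK2 hj hy hX2
  | f + 1, c, j, h, y, hy, hX1, hX2 => by
      simp only [walk2, Bool.and_eq_true, Bool.or_eq_true, decide_eq_true_eq, List.all_eq_true,
        List.mem_range] at h
      obtain ⟨hj, h⟩ := h
      rcases h with (hm | hm) | ⟨-, hall⟩
      · exact outMis_sound hq hρ hm hK hK2 hj hy hX1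
      · exact quadMis_sound hq hdl hnr hU hBu hBp hm hK hK2 hj hy hX2
      · obtain ⟨t, ht⟩ := hy
        obtain ⟨d, hd, hdt⟩ := digit_exists hq.pos t
        have hw := hall d hd
        rw [Nat.cast_pow] at hw
        refine walk2_sound hq hρ hdl hnr hU hBu hBp hK hK2 f _ (j + 1) hw y ?_ hX1 hX2
        obtain ⟨kk, hk⟩ := hdt
        exact ⟨kk, by rw [pow_succ]; linear_combination ht + (q : ℤ) ^ j * hk⟩

/-- **From the scaled relations to the walk**: with `w₀ = q^{2τ}·y₀`, `n = q^τ·n'`, `q ∤ n'`, `2τ ≤ B`, the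
root relation and the pair relation for `(w₀, n)` contradict a certified walk from `(0, 0)`
(take `y = y₀ / n'²` mod `q^N`). [cite: CremonaAlgorithms1997, §3.6] -/
theorem kill_scaled {q : ℕ} (hq : q.Prime) {ρ : ℤ × ℕ × ℤ} (hρ : ¬ (q : ℤ) ∣ ρ.2.2) {dl : ℤ}
    (hdl : ¬ (q : ℤ) ∣ dl) (hnr : eulerBit q dl = false) {U : ℤ × ℤ} (hU : ¬ (q : ℤ) ∣ nm dl U.1 U.2)
    {k : ℕ} {Bp Bu EC : ℤ} (hBu : ¬ (q : ℤ) ∣ Bu) (hBp : (q : ℤ) ∣ Bu - Bp) {s₂ B N f τ : ℕ}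
    (hτ : 2 * τ ≤ B) (hwalk : walk2 q ρ dl k Bp EC s₂ (eulerBit q (nm dl U.1 U.2)) B N f 0 0 = true)
    {w₀ n y₀ n' : ℤ} (hw₀ : w₀ = (q : ℤ) ^ (2 * τ) * y₀) (hn : n = (q : ℤ) ^ τ * n')
    (hnd : ¬ (q : ℤ) ∣ n')
    (h1 : ∃ R : ℤ, (q : ℤ) ^ N ∣ (q : ℤ) ^ ρ.2.1 * ρ.2.2 * R ^ 2 - (w₀ - n ^ 2 * ρ.1))
    (h2 : ∃ P : ℤ × ℤ,
      (q : ℤ) ^ N ∣ (q : ℤ) ^ s₂ * (pmul dl U (pmul dl P P)).1 - (w₀ - n ^ 2 * EC) ∧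
      (q : ℤ) ^ N ∣ (q : ℤ) ^ s₂ * (pmul dl U (pmul dl P P)).2 - (-(n ^ 2 * ((q : ℤ) ^ k * Bu)))) :
    False := by
  have hpZ : Prime (q : ℤ) := Nat.prime_iff_prime_int.mp hq
  have hcop : IsCoprime n' ((q : ℤ) ^ N) := ((Prime.coprime_iff_not_dvd hpZ).mpr hnd).symm.pow_right
  obtain ⟨m, kk, hmk⟩ := hcop
  have hn2 : n ^ 2 = (q : ℤ) ^ (2 * τ) * n' ^ 2 := by rw [hn, mul_pow, ← pow_mul, mul_comm τ 2]
  refine walk2_sound hq hρ hdl hnr hU hBu hBp hτ (by omega) f 0 0 hwalk (y₀ * m ^ 2) (by simp) ?_ ?_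
  · obtain ⟨R, t, ht⟩ := h1
    rw [hw₀, hn2] at ht
    exact ⟨R * m, m ^ 2 * t + (q : ℤ) ^ (2 * τ) * ρ.1 * kk * (1 + m * n'), by
      linear_combination m ^ 2 * ht - (q : ℤ) ^ (2 * τ) * ρ.1 * (1 + m * n') * hmk⟩
  · obtain ⟨P, ⟨t1, ht1⟩, ⟨t2, ht2⟩⟩ := h2
    rw [hw₀, hn2] at ht1
    rw [hn2] at ht2
    simp only [pmul] at ht1 ht2
    refine ⟨(m * P.1, m * P.2), ⟨m ^ 2 * t1 + (q : ℤ) ^ (2 * τ) * EC * kk * (1 + m * n'), ?_⟩,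
      ⟨m ^ 2 * t2 + (q : ℤ) ^ (2 * τ) * ((q : ℤ) ^ k * Bu) * kk * (1 + m * n'), ?_⟩⟩
    · simp only [pmul]
      linear_combination m ^ 2 * ht1 - (q : ℤ) ^ (2 * τ) * EC * (1 + m * n') * hmk
    · simp only [pmul]
      linear_combination m ^ 2 * ht2 - (q : ℤ) ^ (2 * τ) * ((q : ℤ) ^ k * Bu) * (1 + m * n') * hmk

end Summit.BirchSwinnertonDyer.BirchSwinnertonDyer.Rank2Observatory.TwoDescKill
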